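import Summits.QuantumFields.YangMills.Theorems.FluctuationComparisonRegPrIntLPolymerTreeKnit
import Mathlib.Analysis.Complex.Schwarz
import HarnessLib

/-!
# THE ANALYTIC EDITION OF THE POLYMER FORM: BOUNDED ANALYTIC ONE-BOND INTERPOLATIONS ⇒ PER-POLYMER ONE-BOND OSCILLATION, BY THE SCHWARZ LEMMA
# (texts inline, def-free)

Cell `ym3-torus` (YM ladder rung R3 = continuum `SU(2)` Yang–Mills on the three-torus — a RUNG, NOT d = 4, NOT infinite volume, NOT a mass gap, NOT Clay).  Width seat
`ym-ust-20520-w3` (gen 20, LEAD-20520 by lineage); `--supports stmt-QuantumFields-20520 --as helper`, count-neutral, definition-free, default heartbeats.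

WHAT.  ✓`…PolymerTreeKnit` reduced the PATH-B organ S2β (via POLY∘, POLYⁿ∘ of ✓`…PolymerNormKnit`) to the lattice-animal edition POLYᵗ∘: a localized sum over face-connected
`M`-cube polymers `Y` of the level-`J` torus whose terms have ONE-BOND window oscillation `≤ A_J·e^{−κ·d(Y)}`, `A_J` super-polynomially small.  Ideator g24-3's card names
the step from print to that oscillation clause: «(c) oscillation clause = (0.25) + Schwarz corollary» — print gives its localized terms as ANALYTIC functions on the complex
small-field domain [Balaban1987RG1] (1.11)–(1.14) p.262 (per-bond imaginary parts `< α₁`), BOUNDED there by `E₀e^{−κ d_j(X)}` ((0.25) p.257, Thm 1 p.259; the `R`-terms of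
[Balaban1989LargeFieldII] (1.98)–(1.100) p.390 likewise «analytic … ≤ exp(−p₀(g_k))exp(−κd_k(X))»), so along the complex one-bond move `z ↦ U·exp(z·A_b)` (`V = U·exp(A_b)`,
`|A_b| = O(θ_J)`) each term is a bounded analytic function on a disc of radius `R_J ≍ α₁∕θ_J → ∞`, and the Schwarz lemma bounds `|T(V) − T(U)| ≤ 2·B·e^{−κd}∕R_J`.  This
file types that ANALYTIC edition as the row **POLYᵃ∘** and DISCHARGES the Schwarz step:
* §1 ★ `norm_sub_le_of_differentiableOn_ball` — Mathlib-level: `g : ℂ → ℂ` differentiable on `ball 0 R`, `1 < R`, `‖g z‖ ≤ B` on the ball ⟹ `‖g 1 − g 0‖ ≤ 2B∕R`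
  (`Complex.dist_le_div_mul_dist_of_mapsTo_ball`, the Schwarz lemma, with `R₂ := 2B`).
* §2 ★★★ `polymerTreeCan_of_polymerAnalytic : ⟨POLYᵃ∘⟩ → ⟨POLYᵗ∘ VERBATIM⟩` (the binder of ✓`…PolymerTreeKnit.polymerNormCan_of_polymerTree`) with `A_J := 2B∕R_J` —
  **POLYᵃ∘** := POLYᵗ∘'s frame and clauses (i) locality, (ii) face-connected support, (iv) representation VERBATIM; `∃ A` REPLACED by `∃ B ≥ 0` and radii `R : ℕ → ℝ`,
  `1 < R J`, `(J+1)^a∕R J → 0` for every `a`; clause (iii) REPLACED by: for every polymer `Y`, bond `b` and window pair `U, V` agreeing off `b` there is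
  `g : ℂ → ℂ`, differentiable on `ball 0 (R J)`, `‖g z‖ ≤ B·e^{−κ·torusTreeLen Y}` there, `g 0 = T Y U`, `g 1 = T Y V` — print's (1.11)–(1.14) + (0.25) read on the
  one-bond complex line, nothing more.
* §3 ★★★ `fluctuationPartSmall_of_polymerAnalytic : ⟨POLYᵃ∘⟩ → ⟨S2β VERBATIM⟩`, `oneBondOscillation_of_polymerAnalytic : ⟨POLYᵃ∘⟩ → ⟨GRAD∘ VERBATIM⟩`.

NET FOR THE CENSUS.  LINE g24-3's cone: POLYᵃ∘ → POLYᵗ∘ → POLYⁿ∘ → POLY∘ → S2β, all junctions in `Theorems/`; of the card's four named non-print steps, (c) «Schwarz corollary»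
and the lattice-animal resummation are now kernel theorems; (a) the last Mayer step for the most recent large-field strata, (b) the dictionary `descend`∕`ℰp`, (d) torons
remain inside POLYᵃ∘.  CREDITS NOTHING: POLYᵃ∘ is an XL+ letter; registry v11.4 0∕5 unchanged.

HONEST SCOPE.  One Schwarz-lemma corollary + bookkeeping; nothing of Bałaban's analytic content is asserted or proved; POLYᵃ∘ ∕ POLYᵗ∘ ∕ POLYⁿ∘ ∕ POLY∘ ∕ S2β ∕ GRAD∘ ∕ the
five registered ∘-rows ∕ `FluctuationComparisonRegPrIntL` (20520) NOT proved; no summit is proved by a helper; rung R3 = SU(2) YM₃ on T³ — NOT d = 4, NOT infinite volume,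
NOT a mass gap, NOT Clay.  Sorry-free, axioms standard.

References: T. Bałaban, CMP **109** (1987) 249–301 [Balaban1987RG1] (Thm 1 p.259; (0.24)–(0.25) p.257; (1.11)–(1.14) p.262); CMP **116** (1988) 1–22 [Balaban1988RG2Cluster]
((1.26) p.8); CMP **122** (1989) 355–392 [Balaban1989LargeFieldII] ((1.98)–(1.100) p.390); CMP **102** (1985) 255–275 [Balaban1985UV3] (Thm 2 p.263, (41) p.266).
-/

set_option autoImplicit false

noncomputable section

namespace Summit.QuantumFields.YangMills.Theorems.FluctuationComparisonRegPrIntLPolymerAnalyticKnit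

open MeasureTheory Filter Topology Set
open scoped BigOperators
open Literature.MathematicalPhysics.QuantumFieldTheory.Balaban1983to89
open Literature.MathematicalPhysics.QuantumFieldTheory.Balaban1983to89.T3ContinuumYM3Torus
open Literature.MathematicalPhysics.QuantumFieldTheory.Balaban1983to89.T3NestedUnitLaws
open Literature.MathematicalPhysics.QuantumFieldTheory.Balaban1983to89.T3UnitLawDensityEML
open Literature.MathematicalPhysics.QuantumFieldTheory.Balaban1983to89.T3UnitScaleTilt
open Literature.MathematicalPhysics.QuantumFieldTheory.Balaban1983to89.T3TiltDescent
open Literature.MathematicalPhysics.QuantumFieldTheory.Balaban1983to89.T3PrintedRegularMinimiser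
open Literature.MathematicalPhysics.QuantumFieldTheory.Balaban1983to89.T3LevelShift
open Literature.MathematicalPhysics.QuantumFieldTheory.Balaban1983to89.Missing
open Literature.MathematicalPhysics.QuantumFieldTheory.Balaban1983to89.T4Continuum
open Literature.MathematicalPhysics.QuantumFieldTheory.Balaban1983to89.TreeLengthTorus (TPt TFaceConnected torusTreeLen)
open Literature.MathematicalPhysics.QuantumFieldTheory.Balaban1983to89.B12TreeDecay (kappa₀ K₀)
open Literature.MathematicalPhysics.QuantumFieldTheory.Balaban1983to89.B12Decay510Torus (pl1 tcubeOf)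
open Summit.QuantumFields.YangMills.Theorems.FluctuationComparisonRegPrIntLPolymerNormKnit
open Summit.QuantumFields.YangMills.Theorems.FluctuationComparisonRegPrIntLPolymerTreeKnit

/-! ## §1 The Schwarz step: a bounded analytic function on a disc of radius `R > 1` moves by at most `2B∕R` between `0` and `1` -/

/-- ★ **THE SCHWARZ COROLLARY** (the card's step (c), Mathlib-level): if `g : ℂ → ℂ` is complex-differentiable on the open disc `ball 0 R` with `1 < R` and `‖g z‖ ≤ B` there,
then `‖g 1 − g 0‖ ≤ 2B∕R` — the Schwarz lemma `Complex.dist_le_div_mul_dist_of_mapsTo_ball` for the map of `ball 0 R` into `closedBall (g 0) (2B)`.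
[cite: Balaban1987RG1, (1.11)-(1.14) p.262 and (0.25) p.257] -/
theorem norm_sub_le_of_differentiableOn_ball {g : ℂ → ℂ} {R B : ℝ} (hR : 1 < R) (hg : DifferentiableOn ℂ g (Metric.ball 0 R))
    (hB : ∀ z ∈ Metric.ball (0 : ℂ) R, ‖g z‖ ≤ B) : ‖g 1 - g 0‖ ≤ 2 * B / R := by
  have h0 : (0 : ℂ) ∈ Metric.ball (0 : ℂ) R := Metric.mem_ball_self (by linarith)
  have h1 : (1 : ℂ) ∈ Metric.ball (0 : ℂ) R := by
    rw [Metric.mem_ball, dist_zero_right, norm_one]; exact hR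
  have hmaps : MapsTo g (Metric.ball (0 : ℂ) R) (Metric.closedBall (g 0) (2 * B)) := by
    intro z hz
    rw [Metric.mem_closedBall, dist_eq_norm]
    calc ‖g z - g 0‖ ≤ ‖g z‖ + ‖g 0‖ := norm_sub_le _ _
      _ ≤ B + B := add_le_add (hB z hz) (hB 0 h0)
      _ = 2 * B := by ring
  have h := Complex.dist_le_div_mul_dist_of_mapsTo_ball hg hmaps h1
  rw [dist_eq_norm, dist_zero_right, norm_one, mul_one] at h
  exact h

/-! ## §2 POLYᵃ∘ → POLYᵗ∘: `A_J := 2B∕R_J` -/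

/-- ★★★ **POLYᵃ∘ → POLYᵗ∘** — hypothesis = **POLYᵃ∘** (the analytic edition: every term `T Y` of the localized sum, read along the window's one-bond moves, is the pair of
boundary values `g 0, g 1` of a function analytic on `ball 0 (R J)` and bounded there by `B·e^{−κ·d(Y)}`, with `B ≥ 0` uniform and radii `R J > 1` growing
super-polynomially — print's complex small-field domain (1.11)–(1.14) and bound (0.25)); conclusion = POLYᵗ∘ VERBATIM (the binder of
✓`…PolymerTreeKnit.polymerNormCan_of_polymerTree`) with `A J := 2B∕R J` (§1).
[cite: Balaban1987RG1, Thm 1 p.259, (0.24)-(0.25) p.257 and (1.11)-(1.14) p.262; Balaban1989LargeFieldII, (1.98)-(1.100) p.390; Balaban1988RG2Cluster, (1.26) p.8] -/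
theorem polymerTreeCan_of_polymerAnalytic
    (hA : ∀ (L : ℕ), ∃ pS : ℝ, ∀ (b₀ p₀ : ℝ), 0 < b₀ → pS ≤ p₀ → 0 < p₀ → ∃ ε₁ : ℝ, 0 < ε₁ ∧ ∀ (ε₀ : ℝ), 0 < ε₀ → ε₀ ≤ ε₁ →
      ∃ γ₁ : ℝ, 0 < γ₁ ∧ ∃ (M : ℕ) (_ : NeZero M), ∃ κ : ℝ, 0 < κ ∧ 2 * kappa₀ (4 * 2 ^ 3) (2 * 3) ≤ κ ∧
        ∀ (F : T3Family) (γ : ℝ), F.L = L → 0 < γ → γ ≤ γ₁ →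
        ∃ (B : ℝ) (R : ℕ → ℝ), 0 ≤ B ∧ (∀ J, 1 < R J) ∧ (∀ a : ℕ, Tendsto (fun J : ℕ => ((J : ℝ) + 1) ^ a * (R J)⁻¹) atTop (𝓝 0)) ∧
          ∀ (ν : ℕ → (j : ℕ) → Measure (GaugeField (F.P j) 0 (Matrix.specialUnitaryGroup (Fin 2) ℂ))),
            (∀ K, ν K K = T4GenFunBounds.gibbsMeasure (F.P K) ((F.scheme ℰp γ).β K)) →
            (∀ K j, j < K → ν K j = Measure.map (descend F ℰp j) (ν K (j + 1))) →
            ∀ (J K : ℕ) (hJK : J ≤ K) (ρ : GaugeField (F.P J) 0 (Matrix.specialUnitaryGroup (Fin 2) ℂ) → ℝ),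
              (∀ U, PlaqSmall (θBal F.L γ b₀ p₀ J) U → 0 < ρ U) →
              ν K J = (fieldMeasure _ _ _).withDensity (fun U => ENNReal.ofReal (ρ U)) →
              ContinuousOn ρ {U | PlaqSmall (θBal F.L γ b₀ p₀ J) U} →
              ∃ (N : ℕ) (_ : NeZero N) (e : Site (F.P J) 0 ≃ TPt 3 (N * M)),
                (∀ x y : Site (F.P J) 0, (x.tdist y : ℝ) = pl1 (e x - e y)) ∧
                ∃ (c₀ : ℝ) (T : Finset (TPt 3 N) → GaugeField (F.P J) 0 (Matrix.specialUnitaryGroup (Fin 2) ℂ) → ℝ),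
                  (∀ (Y : Finset (TPt 3 N)) (U V : GaugeField (F.P J) 0 (Matrix.specialUnitaryGroup (Fin 2) ℂ)),
                      (∀ b : PBond (F.P J) 0, tcubeOf N M (e b.src) ∈ Y → U b = V b) → T Y U = T Y V) ∧
                  (∀ Y : Finset (TPt 3 N), ¬ TFaceConnected Y → ∀ U : GaugeField (F.P J) 0 (Matrix.specialUnitaryGroup (Fin 2) ℂ), T Y U = 0) ∧
                  (∀ (Y : Finset (TPt 3 N)) (b : PBond (F.P J) 0) (U V : GaugeField (F.P J) 0 (Matrix.specialUnitaryGroup (Fin 2) ℂ)),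
                      PlaqSmall (θBal F.L γ b₀ p₀ J) U → PlaqSmall (θBal F.L γ b₀ p₀ J) V → (∀ e, e ≠ b → U e = V e) →
                      ∃ g : ℂ → ℂ, DifferentiableOn ℂ g (Metric.ball 0 (R J)) ∧
                        (∀ z ∈ Metric.ball (0 : ℂ) (R J), ‖g z‖ ≤ B * Real.exp (-κ * torusTreeLen Y)) ∧
                        g 0 = (T Y U : ℂ) ∧ g 1 = (T Y V : ℂ)) ∧
                  (∀ U : GaugeField (F.P J) 0 (Matrix.specialUnitaryGroup (Fin 2) ℂ), PlaqSmall (θBal F.L γ b₀ p₀ J) U →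
                      Real.log (ρ U) + (F.scheme ℰp γ).β K * minActionRegPr F J K hJK ε₀ U = c₀ + ∑ Y, T Y U)) :
    ∀ (L : ℕ), ∃ pS : ℝ, ∀ (b₀ p₀ : ℝ), 0 < b₀ → pS ≤ p₀ → 0 < p₀ → ∃ ε₁ : ℝ, 0 < ε₁ ∧ ∀ (ε₀ : ℝ), 0 < ε₀ → ε₀ ≤ ε₁ →
      ∃ γ₁ : ℝ, 0 < γ₁ ∧ ∃ (M : ℕ) (_ : NeZero M), ∃ κ : ℝ, 0 < κ ∧ 2 * kappa₀ (4 * 2 ^ 3) (2 * 3) ≤ κ ∧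
        ∀ (F : T3Family) (γ : ℝ), F.L = L → 0 < γ → γ ≤ γ₁ →
        ∃ (A : ℕ → ℝ), (∀ J, 0 ≤ A J) ∧ (∀ a : ℕ, Tendsto (fun J : ℕ => ((J : ℝ) + 1) ^ a * A J) atTop (𝓝 0)) ∧
          ∀ (ν : ℕ → (j : ℕ) → Measure (GaugeField (F.P j) 0 (Matrix.specialUnitaryGroup (Fin 2) ℂ))),
            (∀ K, ν K K = T4GenFunBounds.gibbsMeasure (F.P K) ((F.scheme ℰp γ).β K)) →
            (∀ K j, j < K → ν K j = Measure.map (descend F ℰp j) (ν K (j + 1))) →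
            ∀ (J K : ℕ) (hJK : J ≤ K) (ρ : GaugeField (F.P J) 0 (Matrix.specialUnitaryGroup (Fin 2) ℂ) → ℝ),
              (∀ U, PlaqSmall (θBal F.L γ b₀ p₀ J) U → 0 < ρ U) →
              ν K J = (fieldMeasure _ _ _).withDensity (fun U => ENNReal.ofReal (ρ U)) →
              ContinuousOn ρ {U | PlaqSmall (θBal F.L γ b₀ p₀ J) U} →
              ∃ (N : ℕ) (_ : NeZero N) (e : Site (F.P J) 0 ≃ TPt 3 (N * M)),
                (∀ x y : Site (F.P J) 0, (x.tdist y : ℝ) = pl1 (e x - e y)) ∧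
                ∃ (c₀ : ℝ) (T : Finset (TPt 3 N) → GaugeField (F.P J) 0 (Matrix.specialUnitaryGroup (Fin 2) ℂ) → ℝ),
                  (∀ (Y : Finset (TPt 3 N)) (U V : GaugeField (F.P J) 0 (Matrix.specialUnitaryGroup (Fin 2) ℂ)),
                      (∀ b : PBond (F.P J) 0, tcubeOf N M (e b.src) ∈ Y → U b = V b) → T Y U = T Y V) ∧
                  (∀ Y : Finset (TPt 3 N), ¬ TFaceConnected Y → ∀ U : GaugeField (F.P J) 0 (Matrix.specialUnitaryGroup (Fin 2) ℂ), T Y U = 0) ∧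
                  (∀ (Y : Finset (TPt 3 N)) (b : PBond (F.P J) 0) (U V : GaugeField (F.P J) 0 (Matrix.specialUnitaryGroup (Fin 2) ℂ)),
                      PlaqSmall (θBal F.L γ b₀ p₀ J) U → PlaqSmall (θBal F.L γ b₀ p₀ J) V → (∀ e, e ≠ b → U e = V e) →
                      |T Y U - T Y V| ≤ A J * Real.exp (-κ * torusTreeLen Y)) ∧
                  (∀ U : GaugeField (F.P J) 0 (Matrix.specialUnitaryGroup (Fin 2) ℂ), PlaqSmall (θBal F.L γ b₀ p₀ J) U →
                      Real.log (ρ U) + (F.scheme ℰp γ).β K * minActionRegPr F J K hJK ε₀ U = c₀ + ∑ Y, T Y U) := by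
  intro L
  obtain ⟨pS, HpS⟩ := hA L
  refine ⟨pS, ?_⟩
  intro b₀ p₀ hb₀ hpS hp₀
  obtain ⟨ε₁, hε₁, Hε⟩ := HpS b₀ p₀ hb₀ hpS hp₀
  refine ⟨ε₁, hε₁, ?_⟩
  intro ε₀ hε₀ hε₀₁
  obtain ⟨γ₁, hγ₁, M, instM, κ, hκ, hκ₀, HF⟩ := Hε ε₀ hε₀ hε₀₁
  refine ⟨γ₁, hγ₁, M, instM, κ, hκ, hκ₀, ?_⟩
  intro F γ hFL hγ hγ₁'
  obtain ⟨B, R, hB0, hR1, hR, Hν⟩ := HF F γ hFL hγ hγ₁'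
  have hRpos : ∀ J, 0 < R J := fun J => lt_trans zero_lt_one (hR1 J)
  refine ⟨fun J => 2 * B / R J, fun J => div_nonneg (mul_nonneg (by norm_num) hB0) (hRpos J).le, fun a => ?_, ?_⟩
  · have := (hR a).const_mul (2 * B)
    simp only [mul_zero] at this
    refine this.congr' (Eventually.of_forall fun J => ?_)
    simp only [div_eq_mul_inv]; ring
  intro ν hνK hνd J K hJK ρ hρpos hρν hρcont
  obtain ⟨N, instN, e, he, c₀, T, hloc, hconn, hana, hrep⟩ := Hν ν hνK hνd J K hJK ρ hρpos hρν hρcont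
  refine ⟨N, instN, e, he, c₀, T, hloc, hconn, ?_, hrep⟩
  intro Y b U V hU hV hUV
  obtain ⟨g, hg, hgB, hg0, hg1⟩ := hana Y b U V hU hV hUV
  have h := norm_sub_le_of_differentiableOn_ball (hR1 J) hg hgB
  rw [hg0, hg1, ← Complex.ofReal_sub, Complex.norm_real, Real.norm_eq_abs, abs_sub_comm] at h
  calc |T Y U - T Y V| ≤ 2 * (B * Real.exp (-κ * torusTreeLen Y)) / R J := h
    _ = 2 * B / R J * Real.exp (-κ * torusTreeLen Y) := by ring

/-! ## §3 POLYᵃ∘ → S2β and POLYᵃ∘ → GRAD∘ (compositions with ✓`…PolymerTreeKnit`) -/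

/-- ★★★ **POLYᵃ∘ → S2β**: the PATH-B organ S2β `FluctuationPartSmall` (registry `Lines/semiclassical_s2beta.lean` v11.4 §2 :412) VERBATIM from the analytic edition POLYᵃ∘
(bounded analytic one-bond interpolations of the localized terms), via POLYᵗ∘ (§2) and ✓`fluctuationPartSmall_of_polymerTree`.
[cite: Balaban1987RG1, Thm 1 p.259, (0.24)-(0.25) p.257 and (1.11)-(1.14) p.262; Balaban1988RG2Cluster, (1.26) p.8; Balaban1989LargeFieldII, (1.98)-(1.100) p.390; Balaban1985UV3, Thm 2 p.263 and (41) p.266] -/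
theorem fluctuationPartSmall_of_polymerAnalytic
    (hA : ∀ (L : ℕ), ∃ pS : ℝ, ∀ (b₀ p₀ : ℝ), 0 < b₀ → pS ≤ p₀ → 0 < p₀ → ∃ ε₁ : ℝ, 0 < ε₁ ∧ ∀ (ε₀ : ℝ), 0 < ε₀ → ε₀ ≤ ε₁ →
      ∃ γ₁ : ℝ, 0 < γ₁ ∧ ∃ (M : ℕ) (_ : NeZero M), ∃ κ : ℝ, 0 < κ ∧ 2 * kappa₀ (4 * 2 ^ 3) (2 * 3) ≤ κ ∧
        ∀ (F : T3Family) (γ : ℝ), F.L = L → 0 < γ → γ ≤ γ₁ →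
        ∃ (B : ℝ) (R : ℕ → ℝ), 0 ≤ B ∧ (∀ J, 1 < R J) ∧ (∀ a : ℕ, Tendsto (fun J : ℕ => ((J : ℝ) + 1) ^ a * (R J)⁻¹) atTop (𝓝 0)) ∧
          ∀ (ν : ℕ → (j : ℕ) → Measure (GaugeField (F.P j) 0 (Matrix.specialUnitaryGroup (Fin 2) ℂ))),
            (∀ K, ν K K = T4GenFunBounds.gibbsMeasure (F.P K) ((F.scheme ℰp γ).β K)) →
            (∀ K j, j < K → ν K j = Measure.map (descend F ℰp j) (ν K (j + 1))) →
            ∀ (J K : ℕ) (hJK : J ≤ K) (ρ : GaugeField (F.P J) 0 (Matrix.specialUnitaryGroup (Fin 2) ℂ) → ℝ),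
              (∀ U, PlaqSmall (θBal F.L γ b₀ p₀ J) U → 0 < ρ U) →
              ν K J = (fieldMeasure _ _ _).withDensity (fun U => ENNReal.ofReal (ρ U)) →
              ContinuousOn ρ {U | PlaqSmall (θBal F.L γ b₀ p₀ J) U} →
              ∃ (N : ℕ) (_ : NeZero N) (e : Site (F.P J) 0 ≃ TPt 3 (N * M)),
                (∀ x y : Site (F.P J) 0, (x.tdist y : ℝ) = pl1 (e x - e y)) ∧
                ∃ (c₀ : ℝ) (T : Finset (TPt 3 N) → GaugeField (F.P J) 0 (Matrix.specialUnitaryGroup (Fin 2) ℂ) → ℝ),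
                  (∀ (Y : Finset (TPt 3 N)) (U V : GaugeField (F.P J) 0 (Matrix.specialUnitaryGroup (Fin 2) ℂ)),
                      (∀ b : PBond (F.P J) 0, tcubeOf N M (e b.src) ∈ Y → U b = V b) → T Y U = T Y V) ∧
                  (∀ Y : Finset (TPt 3 N), ¬ TFaceConnected Y → ∀ U : GaugeField (F.P J) 0 (Matrix.specialUnitaryGroup (Fin 2) ℂ), T Y U = 0) ∧
                  (∀ (Y : Finset (TPt 3 N)) (b : PBond (F.P J) 0) (U V : GaugeField (F.P J) 0 (Matrix.specialUnitaryGroup (Fin 2) ℂ)),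
                      PlaqSmall (θBal F.L γ b₀ p₀ J) U → PlaqSmall (θBal F.L γ b₀ p₀ J) V → (∀ e, e ≠ b → U e = V e) →
                      ∃ g : ℂ → ℂ, DifferentiableOn ℂ g (Metric.ball 0 (R J)) ∧
                        (∀ z ∈ Metric.ball (0 : ℂ) (R J), ‖g z‖ ≤ B * Real.exp (-κ * torusTreeLen Y)) ∧
                        g 0 = (T Y U : ℂ) ∧ g 1 = (T Y V : ℂ)) ∧
                  (∀ U : GaugeField (F.P J) 0 (Matrix.specialUnitaryGroup (Fin 2) ℂ), PlaqSmall (θBal F.L γ b₀ p₀ J) U →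
                      Real.log (ρ U) + (F.scheme ℰp γ).β K * minActionRegPr F J K hJK ε₀ U = c₀ + ∑ Y, T Y U)) :
    ∀ (L : ℕ), ∃ pS : ℝ, ∀ (b₀ p₀ : ℝ), 0 < b₀ → pS ≤ p₀ → 0 < p₀ → ∃ ε₁ : ℝ, 0 < ε₁ ∧ ∀ (ε₀ : ℝ), 0 < ε₀ → ε₀ ≤ ε₁ →
      ∃ γ₁ : ℝ, 0 < γ₁ ∧ ∃ κ : ℝ, 0 < κ ∧ ∀ (F : T3Family) (γ : ℝ), F.L = L → 0 < γ → γ ≤ γ₁ →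
        ∃ (φ : ℕ → ℝ), (∀ J, 0 ≤ φ J) ∧ Tendsto (fun J : ℕ => (J : ℝ) * φ J) atTop (𝓝 0) ∧
          ∀ (ν : ℕ → (j : ℕ) → Measure (GaugeField (F.P j) 0 (Matrix.specialUnitaryGroup (Fin 2) ℂ))),
            (∀ K, ν K K = T4GenFunBounds.gibbsMeasure (F.P K) ((F.scheme ℰp γ).β K)) →
            (∀ K j, j < K → ν K j = Measure.map (descend F ℰp j) (ν K (j + 1))) →
            ∀ (J K : ℕ) (hJK : J ≤ K) (ρ : GaugeField (F.P J) 0 (Matrix.specialUnitaryGroup (Fin 2) ℂ) → ℝ),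
              (∀ U, PlaqSmall (θBal F.L γ b₀ p₀ J) U → 0 < ρ U) →
              ν K J = (fieldMeasure _ _ _).withDensity (fun U => ENNReal.ofReal (ρ U)) →
              ContinuousOn ρ {U | PlaqSmall (θBal F.L γ b₀ p₀ J) U} →
              ∀ (b b' : PBond (F.P J) 0) (U V W Z : GaugeField (F.P J) 0 (Matrix.specialUnitaryGroup (Fin 2) ℂ)),
                PlaqSmall (θBal F.L γ b₀ p₀ J) U → PlaqSmall (θBal F.L γ b₀ p₀ J) V →
                PlaqSmall (θBal F.L γ b₀ p₀ J) W → PlaqSmall (θBal F.L γ b₀ p₀ J) Z →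
                (∀ e, e ≠ b → U e = V e) → (∀ e, e ≠ b' → U e = W e) → (∀ e, e ≠ b' → V e = Z e) → (∀ e, e ≠ b → W e = Z e) →
                |((Real.log (ρ U) + (F.scheme ℰp γ).β K * minActionRegPr F J K hJK ε₀ U)
                    - (Real.log (ρ V) + (F.scheme ℰp γ).β K * minActionRegPr F J K hJK ε₀ V))
                  - ((Real.log (ρ W) + (F.scheme ℰp γ).β K * minActionRegPr F J K hJK ε₀ W)
                    - (Real.log (ρ Z) + (F.scheme ℰp γ).β K * minActionRegPr F J K hJK ε₀ Z))|
                  ≤ φ J * Real.exp (-(κ * (b.src.tdist b'.src : ℝ))) :=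
  fluctuationPartSmall_of_polymerTree (polymerTreeCan_of_polymerAnalytic hA)

/-- ★★★ **POLYᵃ∘ → GRAD∘**: LINE g24-1's first-order row GRAD∘ `OneBondOscillationCan` VERBATIM from POLYᵃ∘, via POLYᵗ∘ (§2) and ✓`oneBondOscillation_of_polymerTree`.
[cite: Balaban1987RG1, Thm 1 p.259, (0.24)-(0.25) p.257 and (1.11)-(1.14) p.262; Balaban1988RG2Cluster, (1.26) p.8; Balaban1989LargeFieldII, (1.98)-(1.100) p.390] -/
theorem oneBondOscillation_of_polymerAnalytic
    (hA : ∀ (L : ℕ), ∃ pS : ℝ, ∀ (b₀ p₀ : ℝ), 0 < b₀ → pS ≤ p₀ → 0 < p₀ → ∃ ε₁ : ℝ, 0 < ε₁ ∧ ∀ (ε₀ : ℝ), 0 < ε₀ → ε₀ ≤ ε₁ →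
      ∃ γ₁ : ℝ, 0 < γ₁ ∧ ∃ (M : ℕ) (_ : NeZero M), ∃ κ : ℝ, 0 < κ ∧ 2 * kappa₀ (4 * 2 ^ 3) (2 * 3) ≤ κ ∧
        ∀ (F : T3Family) (γ : ℝ), F.L = L → 0 < γ → γ ≤ γ₁ →
        ∃ (B : ℝ) (R : ℕ → ℝ), 0 ≤ B ∧ (∀ J, 1 < R J) ∧ (∀ a : ℕ, Tendsto (fun J : ℕ => ((J : ℝ) + 1) ^ a * (R J)⁻¹) atTop (𝓝 0)) ∧
          ∀ (ν : ℕ → (j : ℕ) → Measure (GaugeField (F.P j) 0 (Matrix.specialUnitaryGroup (Fin 2) ℂ))),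
            (∀ K, ν K K = T4GenFunBounds.gibbsMeasure (F.P K) ((F.scheme ℰp γ).β K)) →
            (∀ K j, j < K → ν K j = Measure.map (descend F ℰp j) (ν K (j + 1))) →
            ∀ (J K : ℕ) (hJK : J ≤ K) (ρ : GaugeField (F.P J) 0 (Matrix.specialUnitaryGroup (Fin 2) ℂ) → ℝ),
              (∀ U, PlaqSmall (θBal F.L γ b₀ p₀ J) U → 0 < ρ U) →
              ν K J = (fieldMeasure _ _ _).withDensity (fun U => ENNReal.ofReal (ρ U)) →
              ContinuousOn ρ {U | PlaqSmall (θBal F.L γ b₀ p₀ J) U} →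
              ∃ (N : ℕ) (_ : NeZero N) (e : Site (F.P J) 0 ≃ TPt 3 (N * M)),
                (∀ x y : Site (F.P J) 0, (x.tdist y : ℝ) = pl1 (e x - e y)) ∧
                ∃ (c₀ : ℝ) (T : Finset (TPt 3 N) → GaugeField (F.P J) 0 (Matrix.specialUnitaryGroup (Fin 2) ℂ) → ℝ),
                  (∀ (Y : Finset (TPt 3 N)) (U V : GaugeField (F.P J) 0 (Matrix.specialUnitaryGroup (Fin 2) ℂ)),
                      (∀ b : PBond (F.P J) 0, tcubeOf N M (e b.src) ∈ Y → U b = V b) → T Y U = T Y V) ∧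
                  (∀ Y : Finset (TPt 3 N), ¬ TFaceConnected Y → ∀ U : GaugeField (F.P J) 0 (Matrix.specialUnitaryGroup (Fin 2) ℂ), T Y U = 0) ∧
                  (∀ (Y : Finset (TPt 3 N)) (b : PBond (F.P J) 0) (U V : GaugeField (F.P J) 0 (Matrix.specialUnitaryGroup (Fin 2) ℂ)),
                      PlaqSmall (θBal F.L γ b₀ p₀ J) U → PlaqSmall (θBal F.L γ b₀ p₀ J) V → (∀ e, e ≠ b → U e = V e) →
                      ∃ g : ℂ → ℂ, DifferentiableOn ℂ g (Metric.ball 0 (R J)) ∧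
                        (∀ z ∈ Metric.ball (0 : ℂ) (R J), ‖g z‖ ≤ B * Real.exp (-κ * torusTreeLen Y)) ∧
                        g 0 = (T Y U : ℂ) ∧ g 1 = (T Y V : ℂ)) ∧
                  (∀ U : GaugeField (F.P J) 0 (Matrix.specialUnitaryGroup (Fin 2) ℂ), PlaqSmall (θBal F.L γ b₀ p₀ J) U →
                      Real.log (ρ U) + (F.scheme ℰp γ).β K * minActionRegPr F J K hJK ε₀ U = c₀ + ∑ Y, T Y U)) :
    ∀ (L : ℕ), ∃ pS : ℝ, ∀ (b₀ p₀ : ℝ), 0 < b₀ → pS ≤ p₀ → 0 < p₀ → ∃ ε₁ : ℝ, 0 < ε₁ ∧ ∀ (ε₀ : ℝ), 0 < ε₀ → ε₀ ≤ ε₁ →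
      ∃ γ₁ : ℝ, 0 < γ₁ ∧ ∀ (F : T3Family) (γ : ℝ), F.L = L → 0 < γ → γ ≤ γ₁ →
        ∃ (σ : ℕ → ℝ), (∀ J, 0 ≤ σ J) ∧ (∀ a : ℕ, Tendsto (fun J : ℕ => ((J : ℝ) + 1) ^ a * σ J) atTop (𝓝 0)) ∧
          ∀ (ν : ℕ → (j : ℕ) → Measure (GaugeField (F.P j) 0 (Matrix.specialUnitaryGroup (Fin 2) ℂ))),
            (∀ K, ν K K = T4GenFunBounds.gibbsMeasure (F.P K) ((F.scheme ℰp γ).β K)) →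
            (∀ K j, j < K → ν K j = Measure.map (descend F ℰp j) (ν K (j + 1))) →
            ∀ (J K : ℕ) (hJK : J ≤ K) (ρ : GaugeField (F.P J) 0 (Matrix.specialUnitaryGroup (Fin 2) ℂ) → ℝ),
              (∀ U, PlaqSmall (θBal F.L γ b₀ p₀ J) U → 0 < ρ U) →
              ν K J = (fieldMeasure _ _ _).withDensity (fun U => ENNReal.ofReal (ρ U)) →
              ContinuousOn ρ {U | PlaqSmall (θBal F.L γ b₀ p₀ J) U} →
              ∀ (b : PBond (F.P J) 0) (U V : GaugeField (F.P J) 0 (Matrix.specialUnitaryGroup (Fin 2) ℂ)),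
                PlaqSmall (θBal F.L γ b₀ p₀ J) U → PlaqSmall (θBal F.L γ b₀ p₀ J) V →
                (∀ e, e ≠ b → U e = V e) →
                |(Real.log (ρ U) + (F.scheme ℰp γ).β K * minActionRegPr F J K hJK ε₀ U)
                    - (Real.log (ρ V) + (F.scheme ℰp γ).β K * minActionRegPr F J K hJK ε₀ V)| ≤ σ J :=
  oneBondOscillation_of_polymerTree (polymerTreeCan_of_polymerAnalytic hA)

end Summit.QuantumFields.YangMills.Theorems.FluctuationComparisonRegPrIntLPolymerAnalyticKnit

end
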